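import Literature.NumberTheory.EllipticCurves.YanZhu2026.GreenbergDivisibilityProofs
import Literature.NumberTheory.EllipticCurves.YanZhu2026.PerrinRiouCyclotomicRestriction
import Literature.NumberTheory.EllipticCurves.YanZhu2026.CyclotomicMainTheoremIntegral
import Literature.NumberTheory.EllipticCurves.PAdicLFunctionNeZeroHoldsProofs
import Literature.NumberTheory.EllipticCurves.KatoRankBoundMultiplicativeProofs
import Literature.NumberTheory.EllipticCurves.IsogenySelmerInfty
import Literature.NumberTheory.EllipticCurves.Rank1Residual.BigImQuadraticTwistProofs
import HarnessLib

/-!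
# Yan–Zhu 2026 (J. Algebra 693 = arXiv:2412.20078v4), proof of Thm. 4.2, LAST PARAGRAPH (v4 l.1050–1056)
# — the (Im) EQUALITY clause PROVED from its printed inputs: "Moreover, if condition (Im) holds, we can
# establish that part (1) of Conjecture 4.1 is true. The argument is analogous to that of [SU14,
# Theorem 3.30], employing the results of Kato in [Kato, Theorem 17.4], Lemma 5.3, and a commutative
# algebra lemma from [SU14, Lemma 3.2]. The validity of part (1) of the conjecture, in turn, implies that
# part (2) also holds."

`Proofs` companion (theorems only: no definition, no named fact, no instance) of
`YanZhu2026/TwoVariableMainTheorems.lean` (fact `thm42_XOrd₂_isTorsion_charIdeal_le_perrinRiou`, whose LAST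
clause `BigIm W p → SpanLeIdeal (𝓛_p^PR) (Char X_ord)` is the (Im) clause of Thm. 4.2 (1)),
`YanZhu2026/PerrinRiouCyclotomicRestriction.lean` (Prop. 3.7 at print strength, gen 6) and
`YanZhu2026/GreenbergDivisibilityProofs.lean` (gen 5: the INCLUSIONS of Thm. 4.2 from their inputs). Seat
`bsd-littype-04` gen 6, cell `pub/bsd-littype` (typing layer D-0088(4)); OPEN-QUESTIONS-04 Q24 (b). HONEST
FRAMING: typed ≠ proved ≠ endorsed; nothing here proves BSD; these are kernel EDGES between named print
nodes (the equality clauses of [YZ26, Thm. 4.2] modulo REFEREED named inputs instead of the composite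
fact), replayed from the printed proof.

## What is proved (source: arXiv v4 TeX l.1050–1056, quoted in the title; statement 4.1 l.917–927,
Thm. 4.2 l.932–949 [corpus:paper:arxiv-2412.20078 p0010]; Lemma 5.3 l.1086–1093; Prop. 3.7 l.821–829)

The printed argument, made explicit. Write `Λ_K = ℤ_p⟦T₂⟧⟦T₁⟧ ⊃ I = (T₂) = ker(Λ_K → Λ_K⁺ = ℤ_p⟦T₁⟧)`,
`X = 𝒳_{𝓕_ord}(E/K_∞)`, `𝓛 = 𝓛_p^PR(E/K)`, `𝓛⁺ = cycRestrict 𝓛` its image on the cyclotomic line.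
* (DIV) `Char(X) ⊂ (𝓛)` — Thm. 4.2 (1) (hypothesis `hdiv`; in the tree either the clause of the composite
  fact `thm42_…` or the THEOREM `YanZhu2026.idealLeSpan_perrinRiou_of_facts` of the gen-5 file, from Cor.
  4.6 + Thm. 4.7 + Prop. 3.14 + [BCS25, Prop. 4.2.2] + Thm. 3.9).
* (KATO) "[Kato, Theorem 17.4]" for `E` and for `E^K`, integrally — in the tree the (Im) clause of the
  ONE-variable cyclotomic main theorem `YanZhu2026.thm49_charIdeal_eq_padicLFunction_integral` (Yan–Zhu
  Thm. 5.2 = Kato + Skinner–Urban under (Im); for `p > 3` also [BCS25, Thm. 1.1.2 (b)]): `Char(X(E/ℚ_∞)) =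
  (g_E)` with `ι g_E = ϖ · L_p(f_E, α) = 𝓛_p^MSD(E/ℚ)`; for `E^K` only the MEMBERSHIP `g_K ∈
  Char(X(E^K/ℚ_∞))`, `ι g_K = ϖ' · L_p(g, α')`, is used (hypothesis `hK`, see "The `E^K` input" below).
* (L53) Lemma 5.3: `Char(X(E/ℚ_∞)) · Char(X(E^K/ℚ_∞)) ⊂ Char(X) mod I` — fact
  `lemma53_charIdeal_mul_charIdeal_le_toPlus_charIdeal`: some `G ∈ Char(X)` has `Ḡ := toPlus G = g_E g_K`.
* (P37) Prop. 3.7 AT PRINT STRENGTH (`prop37_cycRestrict_perrinRiou_eq_padicLFunction_mul`, gen 6):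
  `𝓛⁺ = ι(u) · ϖϖ' · L_p(f_E, α) L_p(g, α')`, `u ∈ Λ_ℚˣ`. Hence `𝓛⁺ = ι(u · Ḡ)`.
* (ROHRLICH) `L_p(f_E, α) ≠ 0`, `L_p(g, α') ≠ 0` (tree THEOREM `padicLFunction_unitRoot_ne_zero`; and
  `ϖ, ϖ' ≠ 0`, tree `ModularForms.IsNewformOf.periodRatio_ne_zero`), so `𝓛⁺ ≠ 0` and `Ḡ ≠ 0` (Prop. 3.8).
* "[SU14, Lemma 3.2]" = Lemma 3.1.7 of the published numbering (tree THEOREM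
  `SkinnerUrban2014.eq_span_singleton_of_le_of_mem_map`: `𝔞 ⊂ Jac(A)`, `A/𝔞` a domain, `L̄ ≠ 0`,
  `I ⊆ (L)`, `L̄ ∈ Ī` ⟹ `I = (L)`), run here at ELEMENT level because `𝓛` lives in `ℚ_p⟦T⟧⟦S⟧` and is not
  known to lie in `Λ_K` beforehand (`IwasawaAlgebra₂.spanLeIdeal_of_idealLeSpan_of_cycRestrict_eq`, §A):
  by (DIV) `ι(G) = 𝓛 · ι(h)` for some `h ∈ Λ_K`; restricting to the cyclotomic line, `ι(Ḡ) = 𝓛⁺ · ι(h̄) =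
  ι(u Ḡ h̄)`, so `Ḡ (1 − u h̄) = 0` in the domain `ℤ_p⟦T₁⟧`, `u h̄ = 1`, `h̄` is a unit, hence `h` is a
  unit of `Λ_K` (`I = (T₂) ⊂ Jac`: a power series is a unit iff its constant term is —
  `isUnit_iff_isUnit_toPlus`), and `𝓛 = ι(G h⁻¹)` with `G h⁻¹ ∈ Char(X)`: `(𝓛) ⊂ Char(X)`
  (`SpanLeIdeal`). With (DIV): `Char(X) = (G h⁻¹)`, `ι(G h⁻¹) = 𝓛` — statement 4.1 (1).

Theorems (namespace `Literature.NumberTheory.EllipticCurves.YanZhu2026` unless stated):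
* §A (namespace `IwasawaAlgebra₂`) `isUnit_iff_isUnit_toPlus` (private helper `constantCoeff_toPlus`),
  **`spanLeIdeal_of_idealLeSpan_of_cycRestrict_eq`** (the Skinner–Urban step).
* §B **`spanLeIdeal_perrinRiou_of_facts`** — the (Im) clause of Thm. 4.2 (1): granted the named facts
  `thm49_…_integral`, `lemma53_…`, `prop37_…_mul`, and the hypotheses (DIV), `hK`: `(𝓛_p^PR) ⊂ Char(X)`;
  `xOrd₂_charIdeal_eq_span_of_facts` — statement 4.1 (1) `Char(X) = (g)`, `ι(g) = 𝓛_p^PR`; in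
  particular (its first two components) `𝓛_p^PR(E/K) ∈ Λ_K` — Def. 3.4's "`∈ Λ_K`" (l.757–763), which the
  tree's carrier `perrinRiouLFunction` does not assert — holds under these hypotheses as a COROLLARY.
* §C "part (1) implies part (2)": **`span_le_charIdealXGr₂_map_of_spanLeIdeal`** — through Thm. 4.7 at
  `S = {1}` (`thm47_ord_localised_iff_greenbergAnyRoot_localised`, reverse inclusions) `(𝓛_p^Gr) ⊂
  Char(X_Gr)Λ^ur` along every structure map, for every Katz/Greenberg frame; with the gen-5 inclusion
  `charIdealXGr₂_map_le_span_of_facts`: **`charIdealXGr₂_map_eq_span_of_facts`** — statement 4.1 (2)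
  `Char(X_Gr)·𝒪_{ℂ_p}⟦T₁,T₂⟧ = (G)`; and the ordinary equality with (DIV) discharged from the five gen-5
  inputs under `GreenbergSetting` + (Heeg): `xOrd₂_charIdeal_eq_span_of_facts_of_greenbergSetting`.
* §D **`spanLeIdeal_perrinRiou_of_facts_of_minimalTwist`** — §B with the `E^K` input `hK` DISCHARGED by
  name: `thm49_…_integral` for a globally minimal model `W'` of `E^K` (remaining `E^K`-side hypotheses:
  `GoodOrd W' p` and the newform `g` of level `N_{E^K}` with its Néron ratio `ϖ'`), carried to the twisted
  model's datum by `IsogenySelmerInfty.exists_selmerDualData_of_smul_eq` (`Sel_{p^∞}(·/ℚ_∞)^∨` does not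
  depend on the Weierstrass model); irreducibility of `E^K[p]` and (Im) for `E^K` are DERIVED from those
  of `E` (`irr_of_smul_eq_quadraticTwist` below = tree
  `BurungaleSkinnerTianWan2024.hasIrreducibleModPGaloisRep_of_smul_eq_quadraticTwist`, re-proved here in
  8 lines to avoid importing the `p`-converse stack; `Rank1Residual.bigIm_of_smul_eq_quadraticTwist`).

## Hypotheses versus print (numbers, not adjectives)

Print (Thm. 4.2): `ρ̄_E|_{G_K}` absolutely irreducible, Heegner hypothesis, (Im) for `E`. Here: (DIV) is a
hypothesis (print derives it under abs. irreducibility + (Heeg)); `Irr W p` (over `ℚ`, the hypothesis of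
`thm49`) AND `(W.baseChange K).HasIrreducibleModPGaloisRep p` (over `K`, the hypothesis of `lemma53`) —
both implied by print's absolute irreducibility over `G_K` (the `K ⇒ ℚ` implication is summit-side only,
`Summit.….hasIrreducibleModPGaloisRep_of_baseChange`); `BigIm W p` = (Im) verbatim; the level of `π` is
`N_E` (`(N : ℤ) = W.conductorNorm ℤ`, as in `GreenbergSetting.level`). THE `E^K` INPUT `hK`: Kato's
divisibility for the twist, `∃ g_K ∈ Char(X(E^K/ℚ_∞)), ι g_K = ϖ' · L_p(g, α')`, stated on the datum of
the model `W.quadraticTwist d_K` that `lemma53` uses; print obtains it from [Kato, Thm. 17.4] for `E^K`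
(under (Im) for `E`: `τ²` works for `T_p E ⊗ χ_K` since `det ρ_E(τ) = 1` forces `ρ_E(τ)` unipotent — a
Galois-module identification `T_p(E^K) ≅ T_p(E) ⊗ χ_K` the tree does not have); in the tree it is the
conclusion of `thm49_…_integral` (or of `kato_divisibility` (3)) for a globally MINIMAL model `W'` of `E^K`,
which lives on `W'.SelmerDualData`; carrying it to `(W.quadraticTwist d_K).SelmerDualData` is the
invariance of `Sel_{p^∞}(E/ℚ_∞)^∨` under a `ℚ`-isomorphism of models —
`Literature/NumberTheory/EllipticCurves/IsogenySelmerInfty.lean` (§D; OPEN-QUESTIONS-04 Q24 (c)). §B keeps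
`hK` as an explicit hypothesis in the currency of `lemma53` (any source); §D discharges it by name, with
(Im) and irreducibility for `E^K` derived from those for `E` (Q24 (d):
`Rank1Residual/BigImQuadraticTwistProofs.lean` — for odd `p`, `det ρ_E(σ) = 1` and `(ρ_E(σ)-1)T ≅ ℤ_p`
force `(ρ_E(σ)-1)² = 0`, so `σ²` serves for the twist). The one `E^K`-side hypothesis print does not
carry is `GoodOrd W' p` (print: automatic for `p ∤ 2 d_K`; tree: `isOrdinaryAt_of_smul_eq_quadraticTwist`
in `CyclotomicIwasawaMainTheoremIrreducibleBaseChangeProofs.lean` for the squarefree kernel of `d_K`, not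
imported here to keep the closure small). WEAKER than print by exactly: (DIV) a hypothesis (or the gen-5
inputs), `GoodOrd W' p` in §D, (disc) inside `GreenbergSetting` for §C. Never stronger.

## References
* [YanZhu2024MainConjNonCM] X. Yan, X. Zhu, J. Algebra 693 (2026) = arXiv:2412.20078v4: proof of Thm. 4.2,
  last paragraph (TeX l.1050–1056); statement 4.1 (l.917–927); Thm. 4.2 (l.932–949); Lemma 5.3
  (l.1086–1093); Prop. 3.7 (l.821–829); Prop. 3.8 (l.831–836); Def. 3.4 (l.757–763); Thm. 4.7 (l.1022–1034).
* [SkinnerUrban2014] C. Skinner, E. Urban, Invent. Math. 195 (2014), Lemma 3.1.7 (p. 20) (= "Lemma 3.2"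
  of the preprint numbering cited by [YZ26]) and Thm. 3.6.5/3.6.6 (pp. 44–45; "[SU14, Theorem 3.30]").
* [Kato2004Asterisque] K. Kato, Astérisque 295 (2004), Thm. 17.4.
* [RohrlichInventiones1984] D. Rohrlich, Invent. Math. 75 (1984) (tree `padicLFunction_unitRoot_ne_zero`).
* [CastellaGrossiSkinner2025] Prop. 2.2.4 (the proof pointer of Prop. 3.7).
-/

noncomputable section

open scoped Classical

open PowerSeries NumberField IsDedekindDomain Field CongruenceSubgroup
  Literature.NumberTheory.GaloisRepresentations Literature.NumberTheory.EllipticCurves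
  Literature.NumberTheory.EllipticCurves.ModularForms Literature.NumberTheory.EllipticCurves.Rank1Residual

namespace Literature.NumberTheory.EllipticCurves

/-! ## §A. Algebra in `Λ_K = ℤ_p⟦T₂⟧⟦T₁⟧`: units modulo `I = (T₂)`, and the Skinner–Urban step -/

namespace IwasawaAlgebra₂

variable {p : ℕ} [Fact p.Prime]

/-- The constant term of `Ḡ = toPlus G ∈ ℤ_p⟦T₁⟧` is the double constant term `G(0,0) ∈ ℤ_p`. [folklore] -/
private theorem constantCoeff_toPlus (h : IwasawaAlgebra₂ p) :
    PowerSeries.constantCoeff (toPlus p h) = PowerSeries.constantCoeff (PowerSeries.constantCoeff h) := by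
  rw [← PowerSeries.coeff_zero_eq_constantCoeff_apply (toPlus p h), toPlus, PowerSeries.coeff_map,
    PowerSeries.coeff_zero_eq_constantCoeff_apply]

/-- **`I = ker(Λ_K → Λ_K⁺) = (T₂)` lies in the Jacobson radical of `Λ_K`**, in the form used by
[SU14, Lemma 3.1.7]: an element of `Λ_K = ℤ_p⟦T₂⟧⟦T₁⟧` is a unit iff its image in `Λ_K⁺ = ℤ_p⟦T₁⟧` is (both
say: the constant term `G(0,0)` is a unit of `ℤ_p`). [cite: SkinnerUrban2014, Lemma 3.1.7 (p. 20) ("As 𝔞 is contained in the radical of A, it then follows that β is a unit in A")] -/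
theorem isUnit_iff_isUnit_toPlus (h : IwasawaAlgebra₂ p) : IsUnit h ↔ IsUnit (toPlus p h) := by
  rw [PowerSeries.isUnit_iff_constantCoeff, PowerSeries.isUnit_iff_constantCoeff,
    PowerSeries.isUnit_iff_constantCoeff (φ := toPlus p h), constantCoeff_toPlus]

/-- **The Skinner–Urban step ([SU14, Lemma 3.1.7]) of the printed proof of the (Im) clause of [YZ26,
Thm. 4.2 (1)], at element level.** Let `I ⊆ Λ_K` be an ideal with `I ⊂ (L)` for a series
`L ∈ ℚ_p⟦T⟧⟦S⟧` (`IdealLeSpan`: every `g ∈ I` is `L · ι(h_g)`), and suppose some `G ∈ I` reduces, on the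
cyclotomic line, to a generator of `(L⁺)` up to a factor `u ∈ Λ_K⁺ = ℤ_p⟦T₁⟧` (a unit, in the
application): `cycRestrict L = ι(u · Ḡ)`, with `cycRestrict L ≠ 0`. Then `(L) ⊂ I` (`SpanLeIdeal`:
`L = ι(g)` for some `g ∈ I`). Printed proof (SU, p. 20, with `α = G`, `β = h_G`): `ι(Ḡ) = L⁺ ι(h̄) =
ι(u Ḡ h̄)`, so `Ḡ(1 − u h̄) = 0` in the domain `ℤ_p⟦T₁⟧` and `Ḡ ≠ 0`, whence `u h̄ = 1`, `h̄` is a unit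
(and so is `u`), `h` is a unit (`isUnit_iff_isUnit_toPlus`), and `L = ι(G h⁻¹)`. (The tree's `SkinnerUrban2014.eq_span_singleton_of_le_of_mem_map` is the same lemma for
`L ∈ A`; here `L ∈ Λ_K` is a CONSEQUENCE, not a hypothesis.)
[cite: SkinnerUrban2014, Lemma 3.1.7 (p. 20) and proof of Thm. 3.6.5 (p. 44)]
[cite: YanZhu2024MainConjNonCM, proof of Thm. 4.2, last paragraph (arXiv:2412.20078v4 TeX l.1050–1056)] -/
theorem spanLeIdeal_of_idealLeSpan_of_cycRestrict_eq {I : Ideal (IwasawaAlgebra₂ p)}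
    {L : CycAntiSeries p} (hI : IdealLeSpan I L) {G : IwasawaAlgebra₂ p} (hG : G ∈ I)
    {u : IwasawaAlgebra p}
    (hL : cycRestrict L = iwasawaToPowerSeries p (u * toPlus p G)) (hL0 : cycRestrict L ≠ 0) :
    SpanLeIdeal L I := by
  -- (DIV) at `G`: `ι(G) = L · ι(h)`
  obtain ⟨h, hh⟩ := hI G hG
  -- on the cyclotomic line: `Ḡ = u · Ḡ · h̄` in `ℤ_p⟦T₁⟧`
  have hred : toPlus p G = u * toPlus p G * toPlus p h := by
    apply iwasawaToPowerSeries_injective p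
    have h1 := congrArg cycRestrict hh
    rw [cycRestrict_mul, cycRestrict_toCycAnti, cycRestrict_toCycAnti, hL, ← map_mul] at h1
    exact h1
  have hG0 : toPlus p G ≠ 0 := by
    intro h0
    apply hL0
    rw [hL, h0, mul_zero, map_zero]
  -- cancel `Ḡ ≠ 0` in the domain `ℤ_p⟦T₁⟧`: `u h̄ = 1`
  have hone : u * toPlus p h = 1 := by
    have h1 : toPlus p G * (u * toPlus p h - 1) = 0 := by
      rw [mul_sub, mul_one, sub_eq_zero, ← mul_assoc, mul_comm (toPlus p G) u]
      exact hred.symm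
    exact sub_eq_zero.mp ((mul_eq_zero.mp h1).resolve_left hG0)
  -- `h̄` is a unit, hence `h` is a unit of `Λ_K` (`(T₂) ⊂ Jac Λ_K`)
  have hunit : IsUnit h := (isUnit_iff_isUnit_toPlus h).mpr (IsUnit.of_mul_eq_one_right u hone)
  obtain ⟨w, hw⟩ := hunit
  -- `L = ι(G · h⁻¹)` with `G h⁻¹ ∈ I`
  refine ⟨G * ↑w⁻¹, I.mul_mem_right _ hG, ?_⟩
  have hw0 : toCycAnti p h ≠ 0 := by
    rw [← hw]
    exact ((w.isUnit).map (toCycAnti p)).ne_zero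
  apply mul_right_cancel₀ hw0
  rw [← hh, ← map_mul, mul_assoc, ← hw, Units.inv_mul, mul_one]

end IwasawaAlgebra₂

/-! ## §B. The (Im) clause of Theorem 4.2 (1) from its printed inputs -/

namespace YanZhu2026

open IwasawaAlgebra₂ UnrSeries₂ GreenbergVatsal2000 BurungaleCastellaSkinner2025

variable {p : ℕ} [Fact p.Prime]

/-- **Yan–Zhu 2026, Theorem 4.2 (1), the (Im) clause — `(𝓛_p^PR(E/K)) ⊂ Char_{Λ_K}(𝒳_{𝓕_ord}(E/K_∞))`,
hence statement 4.1 (1) — PROVED from its printed inputs** (proof of Thm. 4.2, last paragraph, v4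
l.1050–1056: "[Kato, Theorem 17.4], Lemma 5.3, and a commutative algebra lemma from [SU14, Lemma 3.2]").
Granted the named facts `thm49_charIdeal_eq_padicLFunction_integral` (Kato + Skinner–Urban for `E/ℚ`
under (Im), Yan–Zhu Thm. 5.2), `lemma53_charIdeal_mul_charIdeal_le_toPlus_charIdeal` (Lemma 5.3) and
`prop37_cycRestrict_perrinRiou_eq_padicLFunction_mul` (Prop. 3.7 at print strength), and the hypotheses:
(DIV) `Char(X_ord) ⊂ (𝓛_p^PR)` (`hdiv`; Thm. 4.2 (1), tree theorem `idealLeSpan_perrinRiou_of_facts` or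
the clause of `thm42_…`), Kato's divisibility for `E^K` on the twisted model's datum (`hK`, module
docstring "The `E^K` input"), for: `W` a globally minimal model of `E/ℚ`, `π : X₀(N) → E` with `N = N_E`,
`3 ≤ p` good ordinary, `E[p]` irreducible over `ℚ` (`Irr`) and over `K`, (Im) (`BigIm W p`), `K`
imaginary quadratic with `p` split and `(N_E, D_K) = 1`, `(κ₁, κ₂; γ₁, γ₂)` the cyclotomic/anticyclotomic
pair with `γ₁|_{ℚ̄}` a generator of the cyclotomic `ℤ_p`-extension `κ` of `ℚ` matching the cyclotomic
variable, dual data `D` (`X(E/ℚ_∞)`), `D'` (`X(E^K/ℚ_∞)` on `W.quadraticTwist d_K`), the Néron ratios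
`ϖ, ϖ'` and a globally minimal model `W'` of `E^K` with newform `g`, good ordinary at `p` (for
Rohrlich's `L_p(g, α') ≠ 0`). Conclusion: `SpanLeIdeal (𝓛_p^PR(E/K)) (Char X_ord)` for the type-I frame
`F` of (DIV). [cite: YanZhu2024MainConjNonCM, Thm. 4.2 (1) (Im) clause (arXiv:2412.20078v4 TeX l.944–949) and its proof l.1050–1056, with statement 4.1 (1) l.917–922]
[cite: SkinnerUrban2014, Lemma 3.1.7 (p. 20)] [cite: Kato2004Asterisque, Thm. 17.4]
[cite: RohrlichInventiones1984, Theorem (p. 409)] -/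
theorem spanLeIdeal_perrinRiou_of_facts
    (h49 : thm49_charIdeal_eq_padicLFunction_integral)
    (h53 : lemma53_charIdeal_mul_charIdeal_le_toPlus_charIdeal)
    (h37 : prop37_cycRestrict_perrinRiou_eq_padicLFunction_mul)
    (ι : integralClosure ℚ ℂ →+* ℂ_[p]) (W : WeierstrassCurve ℚ) [W.IsElliptic] [W.IsGloballyMinimal]
    (K : Type) [Field K] [NumberField K] (κ₁ κ₂ : ZpExtension K p) (γ₁ γ₂ : absoluteGaloisGroup K)
    [Fact (ZpExtension.IsTopGeneratorPair κ₁ κ₂ γ₁ γ₂)] {N : ℕ} [NeZero N]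
    (π : ModularParametrizationData W N) (κ : ZpExtension ℚ p)
    (D : W.SelmerDualData κ (absGaloisRestrict ℚ K γ₁))
    (D' : (W.quadraticTwist (NumberField.discr K : ℚ)).SelmerDualData κ (absGaloisRestrict ℚ K γ₁))
    (ϖ : ℚ) (W' : WeierstrassCurve ℚ) [W'.IsElliptic] [W'.IsGloballyMinimal]
    {N' : ℕ} [NeZero N'] (g : CuspForm (Gamma0 N') 2) (ϖ' : ℚ)
    (hlevel : (N : ℤ) = W.conductorNorm ℤ) (hp : 3 ≤ p) (hord : GoodOrd W p) (hirr : Irr W p)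
    (him : BigIm W p) (hK : IsImaginaryQuadratic K)
    (hsplit : ((Ideal.span {(p : ℤ)}).primesOver (𝓞 K)).ncard = 2)
    (hN : IsCoprime (N : ℤ) (NumberField.discr K))
    (hirrK : (W.baseChange K).HasIrreducibleModPGaloisRep p)
    (hκ₁ : κ₁.IsCyclotomic) (hκ₂ : κ₂.IsAnticyclotomic) (hκ : κ.IsCyclotomic)
    (hγ : κ.IsTopGenerator (absGaloisRestrict ℚ K γ₁))
    (hγ' : IsCyclotomicVariable p (absGaloisRestrict ℚ K γ₁))
    (hϖ : (ϖ : ℝ) * W.realPeriodRat = plusPeriod π.f)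
    (hW' : ∃ C : WeierstrassCurve.VariableChange ℚ, C • W' = W.quadraticTwist (NumberField.discr K : ℚ))
    (hg : IsNewformOf W' g) (hϖ' : (ϖ' : ℝ) * W'.realPeriodRat = plusPeriod g) (hord' : GoodOrd W' p)
    (hKato' : ∃ gK ∈ D'.charIdeal,
      iwasawaToPowerSeries p gK = PowerSeries.C (ϖ' : ℚ_[p]) * padicLFunction g (unitRoot W' p : ℚ_[p]))
    {F : CycAntiSeries p} (hF : IsHidaRankinLFunction ι W κ₁ κ₂ π.f F)
    (hdiv : IdealLeSpan (WeierstrassCurve.XOrd₂.charIdeal (W.baseChange K) p κ₁ κ₂ γ₁ γ₂)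
      (perrinRiouLFunction W π F)) :
    SpanLeIdeal (perrinRiouLFunction W π F)
      (WeierstrassCurve.XOrd₂.charIdeal (W.baseChange K) p κ₁ κ₂ γ₁ γ₂) := by
  -- the level of `π` is `N_E`
  obtain rfl : N = W.conductorNorm ℤ := by exact_mod_cast hlevel
  -- (KATO) for `E`: `Char(X(E/ℚ_∞)) = (g_E)`, `ι g_E = ϖ · L_p(f_E, α)`
  obtain ⟨-, gE, hDE, hgE⟩ :=
    h49 W p hp hord hirr him κ (absGaloisRestrict ℚ K γ₁) hκ hγ hγ' π.f π.isNewformOf ϖ hϖ D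
  have hgEmem : gE ∈ D.charIdeal := hDE ▸ Ideal.mem_span_singleton_self gE
  -- (KATO) for `E^K`: `g_K ∈ Char(X(E^K/ℚ_∞))`, `ι g_K = ϖ' · L_p(g, α')`
  obtain ⟨gK, hgKmem, hgK⟩ := hKato'
  -- (L53): `G ∈ Char(X)` with `Ḡ = g_E · g_K`
  obtain ⟨G, hGmem, hGeq⟩ := h53 W K κ₁ κ₂ γ₁ γ₂ κ (absGaloisRestrict ℚ K γ₁) D D' hp hord hK hsplit
    (by exact_mod_cast hN) hirrK hκ₁ hκ₂ hκ hγ hγ gE hgEmem gK hgKmem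
  -- (P37): `𝓛⁺ = ι(u) · ϖϖ' · L_p(f_E) L_p(g)`
  obtain ⟨u, hu⟩ := h37 ι W K κ₁ κ₂ γ₁ γ₂ π ϖ W' g ϖ' hp hord hK hsplit hN hκ₁ hκ₂ hγ' hϖ hW' hg hϖ'
    F hF
  -- so `𝓛⁺ = ι(u · Ḡ)`
  have hGL : iwasawaToPowerSeries p (toPlus p G) =
      PowerSeries.C ((ϖ * ϖ' : ℚ) : ℚ_[p]) *
        (padicLFunction π.f (unitRoot W p : ℚ_[p]) * padicLFunction g (unitRoot W' p : ℚ_[p])) := by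
    rw [hGeq, map_mul, hgE, hgK, Rat.cast_mul, map_mul]
    ring
  have hL : cycRestrict (perrinRiouLFunction W π F) =
      iwasawaToPowerSeries p ((u : IwasawaAlgebra p) * toPlus p G) := by
    rw [hu, map_mul, hGL]
  -- (ROHRLICH): `𝓛⁺ ≠ 0`
  have hL0 : cycRestrict (perrinRiouLFunction W π F) ≠ 0 := by
    rw [hu]
    refine mul_ne_zero ((u.isUnit.map (iwasawaToPowerSeries p)).ne_zero) (mul_ne_zero ?_ (mul_ne_zero
      (padicLFunction_unitRoot_ne_zero ⟨hord.1, hord.2⟩ π.isNewformOf)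
      (padicLFunction_unitRoot_ne_zero ⟨hord'.1, hord'.2⟩ hg)))
    rw [Ne, PowerSeries.ext_iff, not_forall]
    refine ⟨0, ?_⟩
    rw [PowerSeries.coeff_C, if_pos rfl, map_zero]
    exact_mod_cast mul_ne_zero (π.isNewformOf.periodRatio_ne_zero hϖ) (hg.periodRatio_ne_zero hϖ')
  -- [SU14, Lemma 3.1.7]
  exact spanLeIdeal_of_idealLeSpan_of_cycRestrict_eq hdiv hGmem hL hL0

/-- **Yan–Zhu 2026, statement 4.1 (1) under (Im) — `Char_{Λ_K}(𝒳_{𝓕_ord}(E/K_∞)) = (𝓛_p^PR(E/K))`**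
(v4 l.917–922), in the tree's reading: `Char(X_ord)` is the principal ideal of `Λ_K` generated by an
element `g` with `ι(g) = 𝓛_p^PR(E/K)`; from (DIV) and `spanLeIdeal_perrinRiou_of_facts`
(`IdealLeSpan.eq_span_of_spanLeIdeal`). Hypotheses as there.
[cite: YanZhu2024MainConjNonCM, statement 4.1 (1) (arXiv:2412.20078v4 TeX l.917–922) and Thm. 4.2 (Im) clause (l.944–949), proof l.1050–1056] -/
theorem xOrd₂_charIdeal_eq_span_of_facts
    (h49 : thm49_charIdeal_eq_padicLFunction_integral)
    (h53 : lemma53_charIdeal_mul_charIdeal_le_toPlus_charIdeal)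
    (h37 : prop37_cycRestrict_perrinRiou_eq_padicLFunction_mul)
    (ι : integralClosure ℚ ℂ →+* ℂ_[p]) (W : WeierstrassCurve ℚ) [W.IsElliptic] [W.IsGloballyMinimal]
    (K : Type) [Field K] [NumberField K] (κ₁ κ₂ : ZpExtension K p) (γ₁ γ₂ : absoluteGaloisGroup K)
    [Fact (ZpExtension.IsTopGeneratorPair κ₁ κ₂ γ₁ γ₂)] {N : ℕ} [NeZero N]
    (π : ModularParametrizationData W N) (κ : ZpExtension ℚ p)
    (D : W.SelmerDualData κ (absGaloisRestrict ℚ K γ₁))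
    (D' : (W.quadraticTwist (NumberField.discr K : ℚ)).SelmerDualData κ (absGaloisRestrict ℚ K γ₁))
    (ϖ : ℚ) (W' : WeierstrassCurve ℚ) [W'.IsElliptic] [W'.IsGloballyMinimal]
    {N' : ℕ} [NeZero N'] (g : CuspForm (Gamma0 N') 2) (ϖ' : ℚ)
    (hlevel : (N : ℤ) = W.conductorNorm ℤ) (hp : 3 ≤ p) (hord : GoodOrd W p) (hirr : Irr W p)
    (him : BigIm W p) (hK : IsImaginaryQuadratic K)
    (hsplit : ((Ideal.span {(p : ℤ)}).primesOver (𝓞 K)).ncard = 2)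
    (hN : IsCoprime (N : ℤ) (NumberField.discr K))
    (hirrK : (W.baseChange K).HasIrreducibleModPGaloisRep p)
    (hκ₁ : κ₁.IsCyclotomic) (hκ₂ : κ₂.IsAnticyclotomic) (hκ : κ.IsCyclotomic)
    (hγ : κ.IsTopGenerator (absGaloisRestrict ℚ K γ₁))
    (hγ' : IsCyclotomicVariable p (absGaloisRestrict ℚ K γ₁))
    (hϖ : (ϖ : ℝ) * W.realPeriodRat = plusPeriod π.f)
    (hW' : ∃ C : WeierstrassCurve.VariableChange ℚ, C • W' = W.quadraticTwist (NumberField.discr K : ℚ))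
    (hg : IsNewformOf W' g) (hϖ' : (ϖ' : ℝ) * W'.realPeriodRat = plusPeriod g) (hord' : GoodOrd W' p)
    (hKato' : ∃ gK ∈ D'.charIdeal,
      iwasawaToPowerSeries p gK = PowerSeries.C (ϖ' : ℚ_[p]) * padicLFunction g (unitRoot W' p : ℚ_[p]))
    {F : CycAntiSeries p} (hF : IsHidaRankinLFunction ι W κ₁ κ₂ π.f F)
    (hdiv : IdealLeSpan (WeierstrassCurve.XOrd₂.charIdeal (W.baseChange K) p κ₁ κ₂ γ₁ γ₂)
      (perrinRiouLFunction W π F)) :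
    ∃ g₀ ∈ WeierstrassCurve.XOrd₂.charIdeal (W.baseChange K) p κ₁ κ₂ γ₁ γ₂,
      toCycAnti p g₀ = perrinRiouLFunction W π F ∧
        WeierstrassCurve.XOrd₂.charIdeal (W.baseChange K) p κ₁ κ₂ γ₁ γ₂ = Ideal.span {g₀} :=
  hdiv.eq_span_of_spanLeIdeal (spanLeIdeal_perrinRiou_of_facts h49 h53 h37 ι W K κ₁ κ₂ γ₁ γ₂ π κ D D' ϖ
    W' g ϖ' hlevel hp hord hirr him hK hsplit hN hirrK hκ₁ hκ₂ hκ hγ hγ' hϖ hW' hg hϖ' hord' hKato' hF hdiv)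

/-! ## §C. "The validity of part (1) of the conjecture, in turn, implies that part (2) also holds" — via
Thm. 4.7 at `S = {1}` -/

/-- **Part (1) ⟹ part (2), the reverse inclusion** (v4 l.1055–1056 with Thm. 4.7's "The same equivalence
also holds for the reverse inclusions", l.1028–1029): granted `thm47_ord_localised_iff_greenbergAnyRoot_localised`,
under `GreenbergSetting` and irreducibility of `ρ̄_E|_{G_K}`, `(𝓛_p^PR) ⊂ Char(X_ord)` (`SpanLeIdeal`, e.g.
from `spanLeIdeal_perrinRiou_of_facts`) gives `(G) ⊆ Char(X_Gr)·𝒪_{ℂ_p}⟦T₁,T₂⟧` along every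
structure-compatible `J`, for every Katz/Greenberg frame `(LK, G)` at the inverse generators.
[cite: YanZhu2024MainConjNonCM, proof of Thm. 4.2, last sentence (arXiv:2412.20078v4 TeX l.1055–1056) and Thm. 4.7 (l.1022–1034)] -/
theorem span_le_charIdealXGr₂_map_of_spanLeIdeal
    (h47 : thm47_ord_localised_iff_greenbergAnyRoot_localised)
    (ι₁ : integralClosure ℚ ℂ →+* ℂ_[p]) (ι : PadicAlgCl p ≃+* ℂ) (W : WeierstrassCurve ℚ) [W.IsElliptic]
    [W.IsGloballyMinimal] (K : Type) [Field K] [NumberField K] (v vbar : HeightOneSpectrum (𝓞 K))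
    (κ₁ κ₂ : ZpExtension K p) (γ₁ γ₂ : absoluteGaloisGroup K)
    [Fact (ZpExtension.IsTopGeneratorPair κ₁ κ₂ γ₁ γ₂)] {N : ℕ} [NeZero N]
    (π : ModularParametrizationData W N) [NeZero (NumberField.discr K).natAbs]
    (hset : GreenbergSetting ι W N K v vbar κ₁ κ₂)
    (hirr : (W.baseChange K).HasIrreducibleModPGaloisRep p)
    (hι : ∀ z : integralClosure ℚ ℂ, ι₁ z = ((ι.symm (z : ℂ) : PadicAlgCl p) : ℂ_[p]))
    {F : CycAntiSeries p} (hF : IsHidaRankinLFunction ι₁ W κ₁ κ₂ π.f F) (hcF : IsCongruenceIntegral π.f F)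
    {Ω δ : ℂ} {Ωp : (unrIntegers p)ˣ} {LK G : PowerSeries (PowerSeries (PadicComplexInt p))}
    (hLK : IsKatzMeasure₂ ι v vbar ∅ κ₁ κ₂ γ₁⁻¹ γ₂⁻¹ 1 Ω δ ((Ωp : unrIntegers p) : ℂ_[p]) LK)
    (hG : IsGreenbergLFunctionAnyRoot₂ ι v vbar κ₁ κ₂ γ₁⁻¹ γ₂⁻¹ π.f (NumberField.discr K).natAbs
      (NumberField.classNumber K) LK G)
    (J : ℤ_[p] →+* PadicComplexInt p)
    (hJ : ∀ x : ℤ_[p], ((J x : PadicComplexInt p) : ℂ_[p]) = ((x : ℚ_[p]) : ℂ_[p]))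
    (hspan : SpanLeIdeal (perrinRiouLFunction W π F)
      (WeierstrassCurve.XOrd₂.charIdeal (W.baseChange K) p κ₁ κ₂ γ₁ γ₂)) :
    Ideal.span {G} ≤
      (WeierstrassCurve.XGr₂.charIdeal (W.baseChange K) p κ₁ κ₂ vbar γ₁ γ₂).map (toUnr₂ p J) := by
  have h := (h47 ι₁ ι W K v vbar κ₁ κ₂ γ₁ γ₂ π hset hirr hι F hF hcF Ω δ Ωp LK G hLK hG J hJ 1
    one_ne_zero).2
  rw [spanLeIdealAway_one_iff, map_one, exists_span_one_pow_mul_le_iff] at h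
  exact h.mp hspan

/-- **Yan–Zhu 2026, statement 4.1 (2) under (Im) — `Char_{Λ_K}(𝒳_{𝓕_Gr}(E/K_∞))Λ_K^ur = (𝓛_p^Gr(E/K))` —
PROVED from the printed inputs** in the tree's reading (T1)–(T8) of `GreenbergMainTheoremsAnyRoot.lean`:
under `GreenbergSetting` + (Heeg) + irreducibility of `ρ̄_E|_{G_K}`, for every Katz/Greenberg frame
`(LK, G)` at `(γ₁⁻¹, γ₂⁻¹)` and every structure-compatible `J`, `Char(X_Gr)·𝒪_{ℂ_p}⟦T₁,T₂⟧ = (G)`, GIVEN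
the ordinary reverse inclusion `(𝓛_p^PR) ⊂ Char(X_ord)` for the frame's type-I function `F` (`hspan`, the
(Im) clause of part (1): `spanLeIdeal_perrinRiou_of_facts`) — from `charIdealXGr₂_map_le_span_of_facts`
(gen 5: `⊆`, Cor. 4.6 + Thm. 4.7 + Prop. 3.14 + [BCS25, Prop. 4.2.2]) and
`span_le_charIdealXGr₂_map_of_spanLeIdeal` (`⊇`, Thm. 4.7 at `S = {1}`).
[cite: YanZhu2024MainConjNonCM, statement 4.1 (2) (arXiv:2412.20078v4 TeX l.923–927), Thm. 4.2 (Im) clause (l.944–949) and proof l.1036–1056] -/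
theorem charIdealXGr₂_map_eq_span_of_facts
    (h46 : cor46_XOrd₂_charIdeal_le_perrinRiou_awayFromPlus)
    (h47 : thm47_ord_localised_iff_greenbergAnyRoot_localised)
    (h314 : prop314_span_minus_eq_span_bdp_anyRoot) (h422 : prop422_exists_isBDPLFunction_mu_eq_zero)
    (ι₁ : integralClosure ℚ ℂ →+* ℂ_[p]) (ι : PadicAlgCl p ≃+* ℂ) (W : WeierstrassCurve ℚ) [W.IsElliptic]
    [W.IsGloballyMinimal] (K : Type) [Field K] [NumberField K] (v vbar : HeightOneSpectrum (𝓞 K))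
    (κ₁ κ₂ : ZpExtension K p) (γ₁ γ₂ : absoluteGaloisGroup K)
    [Fact (ZpExtension.IsTopGeneratorPair κ₁ κ₂ γ₁ γ₂)] {N : ℕ} [NeZero N]
    (π : ModularParametrizationData W N) [NeZero (NumberField.discr K).natAbs]
    (hset : GreenbergSetting ι W N K v vbar κ₁ κ₂) (hH : SatisfiesHeegnerHypothesis N K)
    (hirr : (W.baseChange K).HasIrreducibleModPGaloisRep p)
    (hι : ∀ z : integralClosure ℚ ℂ, ι₁ z = ((ι.symm (z : ℂ) : PadicAlgCl p) : ℂ_[p]))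
    {F : CycAntiSeries p} (hF : IsHidaRankinLFunction ι₁ W κ₁ κ₂ π.f F) (hcF : IsCongruenceIntegral π.f F)
    {Ω δ : ℂ} {Ωp : (unrIntegers p)ˣ} {LK G : PowerSeries (PowerSeries (PadicComplexInt p))}
    (hLK : IsKatzMeasure₂ ι v vbar ∅ κ₁ κ₂ γ₁⁻¹ γ₂⁻¹ 1 Ω δ ((Ωp : unrIntegers p) : ℂ_[p]) LK)
    (hG : IsGreenbergLFunctionAnyRoot₂ ι v vbar κ₁ κ₂ γ₁⁻¹ γ₂⁻¹ π.f (NumberField.discr K).natAbs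
      (NumberField.classNumber K) LK G)
    (J : ℤ_[p] →+* PadicComplexInt p)
    (hJ : ∀ x : ℤ_[p], ((J x : PadicComplexInt p) : ℂ_[p]) = ((x : ℚ_[p]) : ℂ_[p]))
    (hspan : SpanLeIdeal (perrinRiouLFunction W π F)
      (WeierstrassCurve.XOrd₂.charIdeal (W.baseChange K) p κ₁ κ₂ γ₁ γ₂)) :
    (WeierstrassCurve.XGr₂.charIdeal (W.baseChange K) p κ₁ κ₂ vbar γ₁ γ₂).map (toUnr₂ p J) =
      Ideal.span {G} :=
  le_antisymm
    (charIdealXGr₂_map_le_span_of_facts h46 h47 h314 h422 ι₁ ι W K v vbar κ₁ κ₂ γ₁ γ₂ π hset hH hirr hι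
      hLK hG J hJ)
    (span_le_charIdealXGr₂_map_of_spanLeIdeal h47 ι₁ ι W K v vbar κ₁ κ₂ γ₁ γ₂ π hset hirr hι hF hcF hLK
      hG J hJ hspan)

/-- **The ordinary equality with (DIV) discharged from the gen-5 inputs** (statement 4.1 (1) under (Im) on
the Yan–Zhu locus): under `GreenbergSetting` + (Heeg), irreducibility over `ℚ` and over `K`, (Im), and
the `E^K` input `hK`, granted the EIGHT refereed named facts `thm39_def311_…AnyRoot₂`, `cor46_…`,
`thm47_…AnyRoot…`, `prop314_…_anyRoot`, [BCS25] `prop422_…`, `thm49_…_integral`, `lemma53_…`,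
`prop37_…_mul`: for every type-I frame `F` (with `IsCongruenceIntegral`), `Char(X_ord) = (g₀)` with
`ι(g₀) = 𝓛_p^PR(E/K)`. [cite: YanZhu2024MainConjNonCM, Thm. 4.2 (1) with its (Im) clause (arXiv:2412.20078v4 TeX l.932–949) and proof l.1036–1056] -/
theorem xOrd₂_charIdeal_eq_span_of_facts_of_greenbergSetting
    (h39 : thm39_def311_exists_isGreenbergLFunctionAnyRoot₂)
    (h46 : cor46_XOrd₂_charIdeal_le_perrinRiou_awayFromPlus)
    (h47 : thm47_ord_localised_iff_greenbergAnyRoot_localised)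
    (h314 : prop314_span_minus_eq_span_bdp_anyRoot) (h422 : prop422_exists_isBDPLFunction_mu_eq_zero)
    (h49 : thm49_charIdeal_eq_padicLFunction_integral)
    (h53 : lemma53_charIdeal_mul_charIdeal_le_toPlus_charIdeal)
    (h37 : prop37_cycRestrict_perrinRiou_eq_padicLFunction_mul)
    (ι₁ : integralClosure ℚ ℂ →+* ℂ_[p]) (ι : PadicAlgCl p ≃+* ℂ) (W : WeierstrassCurve ℚ) [W.IsElliptic]
    [W.IsGloballyMinimal] (K : Type) [Field K] [NumberField K] (v vbar : HeightOneSpectrum (𝓞 K))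
    (κ₁ κ₂ : ZpExtension K p) (γ₁ γ₂ : absoluteGaloisGroup K)
    [Fact (ZpExtension.IsTopGeneratorPair κ₁ κ₂ γ₁ γ₂)] {N : ℕ} [NeZero N]
    (π : ModularParametrizationData W N) [NeZero (NumberField.discr K).natAbs] (κ : ZpExtension ℚ p)
    (D : W.SelmerDualData κ (absGaloisRestrict ℚ K γ₁))
    (D' : (W.quadraticTwist (NumberField.discr K : ℚ)).SelmerDualData κ (absGaloisRestrict ℚ K γ₁))
    (ϖ : ℚ) (W' : WeierstrassCurve ℚ) [W'.IsElliptic] [W'.IsGloballyMinimal]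
    {N' : ℕ} [NeZero N'] (g : CuspForm (Gamma0 N') 2) (ϖ' : ℚ)
    (hset : GreenbergSetting ι W N K v vbar κ₁ κ₂) (hH : SatisfiesHeegnerHypothesis N K)
    (hirr : Irr W p) (hirrK : (W.baseChange K).HasIrreducibleModPGaloisRep p) (him : BigIm W p)
    (hι : ∀ z : integralClosure ℚ ℂ, ι₁ z = ((ι.symm (z : ℂ) : PadicAlgCl p) : ℂ_[p]))
    (hκ : κ.IsCyclotomic) (hγ : κ.IsTopGenerator (absGaloisRestrict ℚ K γ₁))
    (hγ' : IsCyclotomicVariable p (absGaloisRestrict ℚ K γ₁))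
    (hϖ : (ϖ : ℝ) * W.realPeriodRat = plusPeriod π.f)
    (hW' : ∃ C : WeierstrassCurve.VariableChange ℚ, C • W' = W.quadraticTwist (NumberField.discr K : ℚ))
    (hg : IsNewformOf W' g) (hϖ' : (ϖ' : ℝ) * W'.realPeriodRat = plusPeriod g) (hord' : GoodOrd W' p)
    (hKato' : ∃ gK ∈ D'.charIdeal,
      iwasawaToPowerSeries p gK = PowerSeries.C (ϖ' : ℚ_[p]) * padicLFunction g (unitRoot W' p : ℚ_[p]))
    {F : CycAntiSeries p} (hF : IsHidaRankinLFunction ι₁ W κ₁ κ₂ π.f F) (hcF : IsCongruenceIntegral π.f F) :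
    ∃ g₀ ∈ WeierstrassCurve.XOrd₂.charIdeal (W.baseChange K) p κ₁ κ₂ γ₁ γ₂,
      toCycAnti p g₀ = perrinRiouLFunction W π F ∧
        WeierstrassCurve.XOrd₂.charIdeal (W.baseChange K) p κ₁ κ₂ γ₁ γ₂ = Ideal.span {g₀} :=
  xOrd₂_charIdeal_eq_span_of_facts h49 h53 h37 ι₁ W K κ₁ κ₂ γ₁ γ₂ π κ D D' ϖ W' g ϖ' hset.level
    hset.three_le hset.goodOrd hirr him hset.isImaginaryQuadratic hset.split hset.coprime hirrK
    hset.cyclotomic hset.anticyclotomic hκ hγ hγ' hϖ hW' hg hϖ' hord' hKato' hF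
    (idealLeSpan_perrinRiou_of_facts h39 h46 h47 h314 h422 ι₁ ι W K v vbar κ₁ κ₂ γ₁ γ₂ π hset hH hirrK hι
      hF hcF)

/-! ## §D. The `E^K` input by name: Kato + Skinner–Urban for a MINIMAL model of the twist, transported
to the twisted model's datum (`IsogenySelmerInfty.exists_selmerDualData_of_smul_eq`); (Im) and
irreducibility for `E^K` from those for `E` -/

/-- Irreducibility of `E[p]` passes to any model `W'` of a quadratic twist, `C • W' = W^{(d)}` (`d ≠ 0`):
`W` is in turn a model of `W'^{(d)}` (`(W^{(d)})^{(d)} = W^{(d²)} ≅ W`), so a rational line of `E'[p]`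
would give one of `E[p]` (`Rank1Residual.not_hasIrreducibleModPGaloisRep_twist`). This is the tree theorem
`BurungaleSkinnerTianWan2024.hasIrreducibleModPGaloisRep_of_smul_eq_quadraticTwist` verbatim, re-proved
here (same 5-line proof) only because its module imports the whole `p`-converse stack.
[cite: SilvermanAEC2009, X.5 Cor. 5.4] -/
theorem irr_of_smul_eq_quadraticTwist (W W' : WeierstrassCurve ℚ) [W.IsElliptic] [W'.IsElliptic]
    {d : ℚ} (hd : d ≠ 0) {C : WeierstrassCurve.VariableChange ℚ} (hC : C • W' = W.quadraticTwist d)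
    (hirr : Irr W p) : Irr W' p := by
  by_contra hred
  obtain ⟨D, hD⟩ := W.exists_quadraticTwist_quadraticTwist_eq_smul hd
  have hW' : W' = C⁻¹ • W.quadraticTwist d := by rw [← hC, inv_smul_smul]
  have key : ((⟨C⁻¹.u, d * C⁻¹.r, 0, 0⟩ : WeierstrassCurve.VariableChange ℚ) * D) • W =
      W'.quadraticTwist d := by
    rw [mul_smul, ← hD, hW', WeierstrassCurve.quadraticTwist_smul]
  exact not_hasIrreducibleModPGaloisRep_twist hred hd W _ key hirr

/-- **The (Im) clause of Theorem 4.2 (1) with the `E^K` input discharged by name** (OPEN-QUESTIONS-04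
Q24 (c), (d) closed): as `spanLeIdeal_perrinRiou_of_facts`, but the hypothesis `hK` (Kato's divisibility
for `E^K` on the datum of `W.quadraticTwist d_K`) is now DERIVED from the named fact
`thm49_charIdeal_eq_padicLFunction_integral` applied to the globally minimal model `W'` of `E^K` — its
hypotheses for `W'` being: good ordinary at `p` (KEPT, `hord'`), `E^K[p]` irreducible (DERIVED from
`Irr W p`, `irr_of_smul_eq_quadraticTwist`), (Im) for `E^K` (DERIVED from (Im) for `E` for odd `p`,
`Rank1Residual.bigIm_of_smul_eq_quadraticTwist`), the newform `g` at level `N_{E^K}` with Néron ratio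
`ϖ'` (data) — and from the invariance of `Sel_{p^∞}(·/ℚ_∞)^∨` under the `ℚ`-isomorphism
`C • W' = W.quadraticTwist d_K` (`IsogenySelmerInfty.exists_selmerDualData_of_smul_eq`: same `Λ`-module,
same characteristic ideal). Print (v4 l.1050–1056) invokes [Kato, Thm. 17.4] for `E^K` under (Im) for
`E`; this is that step, by name.
[cite: YanZhu2024MainConjNonCM, Thm. 4.2 (1) (Im) clause (arXiv:2412.20078v4 TeX l.944–949) and its proof l.1050–1056]
[cite: GreenbergLNM1716, §1 (the Λ-module X(E/F_∞) is attached to E/F)] -/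
theorem spanLeIdeal_perrinRiou_of_facts_of_minimalTwist
    (h49 : thm49_charIdeal_eq_padicLFunction_integral)
    (h53 : lemma53_charIdeal_mul_charIdeal_le_toPlus_charIdeal)
    (h37 : prop37_cycRestrict_perrinRiou_eq_padicLFunction_mul)
    (ι : integralClosure ℚ ℂ →+* ℂ_[p]) (W : WeierstrassCurve ℚ) [W.IsElliptic] [W.IsGloballyMinimal]
    (K : Type) [Field K] [NumberField K] (κ₁ κ₂ : ZpExtension K p) (γ₁ γ₂ : absoluteGaloisGroup K)
    [Fact (ZpExtension.IsTopGeneratorPair κ₁ κ₂ γ₁ γ₂)] {N : ℕ} [NeZero N]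
    (π : ModularParametrizationData W N) (κ : ZpExtension ℚ p)
    (D : W.SelmerDualData κ (absGaloisRestrict ℚ K γ₁))
    (D' : (W.quadraticTwist (NumberField.discr K : ℚ)).SelmerDualData κ (absGaloisRestrict ℚ K γ₁))
    (ϖ : ℚ) (W' : WeierstrassCurve ℚ) [W'.IsElliptic] [W'.IsGloballyMinimal]
    [NeZero (W'.conductorNorm ℤ)] (g : CuspForm (Gamma0 (W'.conductorNorm ℤ)) 2) (ϖ' : ℚ)
    (hlevel : (N : ℤ) = W.conductorNorm ℤ) (hp : 3 ≤ p) (hord : GoodOrd W p) (hirr : Irr W p)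
    (him : BigIm W p) (hK : IsImaginaryQuadratic K)
    (hsplit : ((Ideal.span {(p : ℤ)}).primesOver (𝓞 K)).ncard = 2)
    (hN : IsCoprime (N : ℤ) (NumberField.discr K))
    (hirrK : (W.baseChange K).HasIrreducibleModPGaloisRep p)
    (hκ₁ : κ₁.IsCyclotomic) (hκ₂ : κ₂.IsAnticyclotomic) (hκ : κ.IsCyclotomic)
    (hγ : κ.IsTopGenerator (absGaloisRestrict ℚ K γ₁))
    (hγ' : IsCyclotomicVariable p (absGaloisRestrict ℚ K γ₁))
    (hϖ : (ϖ : ℝ) * W.realPeriodRat = plusPeriod π.f)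
    (hW' : ∃ C : WeierstrassCurve.VariableChange ℚ, C • W' = W.quadraticTwist (NumberField.discr K : ℚ))
    (hg : IsNewformOf W' g) (hϖ' : (ϖ' : ℝ) * W'.realPeriodRat = plusPeriod g) (hord' : GoodOrd W' p)
    {F : CycAntiSeries p} (hF : IsHidaRankinLFunction ι W κ₁ κ₂ π.f F)
    (hdiv : IdealLeSpan (WeierstrassCurve.XOrd₂.charIdeal (W.baseChange K) p κ₁ κ₂ γ₁ γ₂)
      (perrinRiouLFunction W π F)) :
    SpanLeIdeal (perrinRiouLFunction W π F)
      (WeierstrassCurve.XOrd₂.charIdeal (W.baseChange K) p κ₁ κ₂ γ₁ γ₂) := by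
  obtain ⟨C, hC⟩ := hW'
  have hd : (NumberField.discr K : ℚ) ≠ 0 := by exact_mod_cast NumberField.discr_ne_zero K
  -- `E^K[p]` irreducible and (Im) for `E^K`, from `E` (odd `p`)
  have hirr' : Irr W' p := irr_of_smul_eq_quadraticTwist W W' hd hC hirr
  have him' : BigIm W' p := bigIm_of_smul_eq_quadraticTwist p W W' (by omega) hd hC him
  -- transport the twisted model's datum to the minimal model `W'` (same `Λ`-module)
  obtain ⟨D'', hchar, -⟩ := IsogenySelmerInfty.exists_selmerDualData_of_smul_eq p hC D'
  -- (KATO) for `E^K` on the minimal model: `Char(X(E^K/ℚ_∞)) = (g_K)`, `ι g_K = ϖ' · L_p(g, α')`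
  obtain ⟨-, gK, hDK, hgK⟩ :=
    h49 W' p hp hord' hirr' him' κ (absGaloisRestrict ℚ K γ₁) hκ hγ hγ' g hg ϖ' hϖ' D''
  have hKato' : ∃ gK ∈ D'.charIdeal, iwasawaToPowerSeries p gK =
      PowerSeries.C (ϖ' : ℚ_[p]) * padicLFunction g (unitRoot W' p : ℚ_[p]) :=
    ⟨gK, hchar ▸ hDK ▸ Ideal.mem_span_singleton_self gK, hgK⟩
  exact spanLeIdeal_perrinRiou_of_facts h49 h53 h37 ι W K κ₁ κ₂ γ₁ γ₂ π κ D D' ϖ W' g ϖ' hlevel hp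
    hord hirr him hK hsplit hN hirrK hκ₁ hκ₂ hκ hγ hγ' hϖ ⟨C, hC⟩ hg hϖ' hord' hKato' hF hdiv

end YanZhu2026

end Literature.NumberTheory.EllipticCurves

end
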